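import Mathlib
import Literature.MathematicalPhysics.StatisticalMechanics.OneCrossingMixture

/-!
# Crux `ExactCertificate` (stmt-AtomisticToContinuum-11959), line `closure-makes-nogap-exact`,
# Transfer1D skeleton (`ExactCertificate1D`): stub `stub_crossing`

Support file for the crux `ThreeConeCertificate.ExactCertificate`, d = 1 transfer skeleton
`Cruxes.ExactCertificate.Transfer1D.ExactCertificate1D`.  This file proves the registered stub
`stub_crossing`, THE mechanism of the d = 1 exact Lennard-Jones certificate: the one sign change of
the Laplace density of `−lennardJones`.

With `p(t) = t⁵/720 − t¹¹/479001600 = t⁵ (665280 − t⁶)/479001600` (`−lennardJones r =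
∫₀^∞ e^{−tr} p(t) dt`; `p ≥ 0` on `(0, t₀]`, `p ≤ 0` on `[t₀, ∞)`, `t₀⁶ = 665280 = 12!/6!`) and
`b = (k+1) a > 0`:

* `moment_eq` — the `t`-moment `∫₀^∞ e^{−tb} p(t) t dt = b⁻⁷ − b⁻¹³` (Euler's integral
  `∫₀^∞ e^{−tb} tⁿ dt = n!/bⁿ⁺¹`, tree lemma `integral_exp_neg_mul_mul_pow`, `n = 6, 12`);
* `integrand_sub_nonneg` — for `h` antitone on `(0, ∞)` and `t > 0`,
  `e^{−tb} p(t) t (h t − h t₀) ≥ 0` (both factors change sign at `t₀`, in opposite directions);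
* `moment_mul_le_integral` — hence `h(t₀) (b⁻⁷ − b⁻¹³) ≤ ∫₀^∞ e^{−tb} p(t) t h(t) dt`;
* **`stub_crossing`** — summing with weights `k + 1` against the zero-pressure identity
  `Σ_k (k+1) (((k+1)a)⁻⁷ − ((k+1)a)⁻¹³) = 0`:
  `0 = h(t₀) · 0 ≤ Σ_k (k+1) ∫₀^∞ e^{−t(k+1)a} p(t) t h(t) dt`.

All `[folklore]` (sign-change / variation-diminishing bookkeeping for Laplace transforms,
cf. Pólya–Szegő, *Aufgaben und Lehrsätze* II, Part V); no named facts are used.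
-/

noncomputable section

namespace Summit.AtomisticToContinuum.Crystallization.Theorems.ThreeConeCertificateExactCertificate.Transfer1D

open Literature.MathematicalPhysics.StatisticalMechanics MeasureTheory Set

/-! ## The `t`-moment of the density -/

/-- `t ↦ e^{−tb} p(t) t` is integrable on `(0, ∞)` for `b > 0` (two Gamma integrands).
[folklore] -/
theorem integrableOn_moment {b : ℝ} (hb : 0 < b) :
    IntegrableOn (fun t : ℝ => Real.exp (-(t * b)) * (t ^ 5 / 720 - t ^ 11 / 479001600) * t)
      (Ioi 0) := by
  have h := ((integrableOn_exp_neg_mul_mul_pow 6 hb).div_const 720).sub'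
    ((integrableOn_exp_neg_mul_mul_pow 12 hb).div_const 479001600)
  refine IntegrableOn.congr_fun h (fun t _ => ?_) measurableSet_Ioi
  ring

/-- **The `t`-moment**: `∫₀^∞ e^{−tb} p(t) t dt = b⁻⁷ − b⁻¹³` for `b > 0`
(`∫₀^∞ e^{−tb} t⁶ dt = 6!/b⁷ = 720/b⁷`, `∫₀^∞ e^{−tb} t¹² dt = 12!/b¹³ = 479001600/b¹³`).
[folklore] -/
theorem moment_eq {b : ℝ} (hb : 0 < b) :
    ∫ t in Ioi (0 : ℝ), Real.exp (-(t * b)) * (t ^ 5 / 720 - t ^ 11 / 479001600) * t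
      = b⁻¹ ^ 7 - b⁻¹ ^ 13 := by
  have hi6 : Integrable (fun t : ℝ => Real.exp (-(t * b)) * t ^ 6) (volume.restrict (Ioi 0)) :=
    integrableOn_exp_neg_mul_mul_pow 6 hb
  have hi12 : Integrable (fun t : ℝ => Real.exp (-(t * b)) * t ^ 12) (volume.restrict (Ioi 0)) :=
    integrableOn_exp_neg_mul_mul_pow 12 hb
  have e : ∀ t : ℝ, Real.exp (-(t * b)) * (t ^ 5 / 720 - t ^ 11 / 479001600) * t =
      Real.exp (-(t * b)) * t ^ 6 / 720 - Real.exp (-(t * b)) * t ^ 12 / 479001600 := fun t => by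
    ring
  simp_rw [e]
  rw [integral_sub (hi6.div_const 720) (hi12.div_const 479001600), integral_div, integral_div,
    integral_exp_neg_mul_mul_pow 6 hb, integral_exp_neg_mul_mul_pow 12 hb]
  norm_num [Nat.factorial]
  ring

/-! ## One sign change against an antitone weight -/

/-- The crossing point: a positive real `t₀` with `t₀⁶ = 665280` (namely `665280^{1/6}`).
[folklore] -/
theorem exists_crossing : ∃ t₀ : ℝ, 0 < t₀ ∧ t₀ ^ 6 = 665280 :=
  ⟨(665280 : ℝ) ^ (1 / 6 : ℝ), Real.rpow_pos_of_pos (by norm_num) _, by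
    rw [← Real.rpow_natCast, ← Real.rpow_mul (by norm_num)]
    norm_num⟩

/-- **Pointwise sign.** For `h` antitone on `(0, ∞)`, `t₀ > 0` with `t₀⁶ = 665280`, any real `b`
and `t > 0`: `e^{−tb} p(t) (t h(t)) − h(t₀) (e^{−tb} p(t) t) = e^{−tb} p(t) t (h t − h t₀) ≥ 0`,
since `p(t) = t⁵ (665280 − t⁶)/479001600` and `h t − h t₀` are both `≥ 0` for `t ≤ t₀` and both
`≤ 0` for `t ≥ t₀`. [folklore] -/
theorem integrand_sub_nonneg {t₀ : ℝ} (ht₀ : 0 < t₀) (h6 : t₀ ^ 6 = 665280) {h : ℝ → ℝ}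
    (hh : AntitoneOn h (Ioi 0)) (b : ℝ) {t : ℝ} (ht : 0 < t) :
    0 ≤ Real.exp (-(t * b)) * (t ^ 5 / 720 - t ^ 11 / 479001600) * (t * h t)
      - h t₀ * (Real.exp (-(t * b)) * (t ^ 5 / 720 - t ^ 11 / 479001600) * t) := by
  have hp : t ^ 5 / 720 - t ^ 11 / 479001600 = t ^ 5 * (665280 - t ^ 6) / 479001600 := by ring
  have hexp : 0 ≤ Real.exp (-(t * b)) := (Real.exp_pos _).le
  have ht5 : 0 ≤ t ^ 5 := by positivity
  have key : 0 ≤ Real.exp (-(t * b)) * (t ^ 5 / 720 - t ^ 11 / 479001600) * t * (h t - h t₀) := by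
    rcases le_total t t₀ with hle | hle
    · -- below the crossing: `p t ≥ 0` and `h t₀ ≤ h t`
      have h6' : t ^ 6 ≤ 665280 := h6 ▸ pow_le_pow_left₀ ht.le hle 6
      have hp0 : 0 ≤ t ^ 5 / 720 - t ^ 11 / 479001600 := by
        rw [hp]
        exact div_nonneg (mul_nonneg ht5 (by linarith)) (by norm_num)
      have hh0 : 0 ≤ h t - h t₀ := sub_nonneg.2 (hh ht ht₀ hle)
      exact mul_nonneg (mul_nonneg (mul_nonneg hexp hp0) ht.le) hh0
    · -- above the crossing: `p t ≤ 0` and `h t ≤ h t₀`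
      have h6' : 665280 ≤ t ^ 6 := h6 ▸ pow_le_pow_left₀ ht₀.le hle 6
      have hp0 : 0 ≤ -(t ^ 5 / 720 - t ^ 11 / 479001600) := by
        rw [hp, ← neg_div, ← mul_neg]
        exact div_nonneg (mul_nonneg ht5 (by linarith)) (by norm_num)
      have hh0 : 0 ≤ h t₀ - h t := sub_nonneg.2 (hh ht₀ ht hle)
      have := mul_nonneg (mul_nonneg (mul_nonneg hexp hp0) ht.le) hh0
      exact this.trans_eq (by ring)
  exact key.trans_eq (by ring)

/-- **Moment comparison.** For `b > 0`, `h` antitone on `(0, ∞)` with `e^{−tb} p(t) (t h(t))`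
integrable on `(0, ∞)`, and the crossing point `t₀`:
`h(t₀) (b⁻⁷ − b⁻¹³) ≤ ∫₀^∞ e^{−tb} p(t) (t h(t)) dt` (integrate `integrand_sub_nonneg`).
[folklore] -/
theorem moment_mul_le_integral {t₀ : ℝ} (ht₀ : 0 < t₀) (h6 : t₀ ^ 6 = 665280) {h : ℝ → ℝ}
    (hh : AntitoneOn h (Ioi 0)) {b : ℝ} (hb : 0 < b)
    (hint : IntegrableOn (fun t : ℝ => Real.exp (-(t * b)) * (t ^ 5 / 720 - t ^ 11 / 479001600)
      * (t * h t)) (Ioi 0)) :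
    h t₀ * (b⁻¹ ^ 7 - b⁻¹ ^ 13) ≤ ∫ t in Ioi (0 : ℝ), Real.exp (-(t * b))
      * (t ^ 5 / 720 - t ^ 11 / 479001600) * (t * h t) := by
  have hgi := (integrableOn_moment hb).const_mul (h t₀)
  have hdiff : 0 ≤ ∫ t in Ioi (0 : ℝ), (Real.exp (-(t * b)) * (t ^ 5 / 720 - t ^ 11 / 479001600)
      * (t * h t) - h t₀ * (Real.exp (-(t * b)) * (t ^ 5 / 720 - t ^ 11 / 479001600) * t)) :=
    setIntegral_nonneg measurableSet_Ioi fun t ht => integrand_sub_nonneg ht₀ h6 hh b ht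
  rw [integral_sub hint hgi, integral_const_mul, moment_eq hb] at hdiff
  linarith

/-! ## The registered stub -/

/-- **`stub_crossing`** (registered stub of the Transfer1D skeleton of line
`closure-makes-nogap-exact`).  For `a > 0` at zero pressure
(`Σ_k (k+1) (((k+1)a)⁻⁷ − ((k+1)a)⁻¹³) = 0`, i.e. the `(k+1)`-weighted `t`-moments of
`e^{−t(k+1)a} p(t)` sum to zero) and every `h` antitone on `(0, ∞)` (with the integrands integrable
and the series summable): `0 ≤ Σ_k (k+1) ∫₀^∞ e^{−t(k+1)a} p(t) t h(t) dt`.  Termwise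
`(k+1) ∫ e^{−t(k+1)a} p(t) t h(t) dt ≥ h(t₀) (k+1) (((k+1)a)⁻⁷ − ((k+1)a)⁻¹³)`
(`moment_mul_le_integral`), and the right-hand sides sum to `h(t₀) · 0 = 0`. [folklore] -/
theorem stub_crossing : ∀ a : ℝ, 0 < a →
    HasSum (fun k : ℕ => ((k : ℝ) + 1) * ((((k : ℝ) + 1) * a)⁻¹ ^ 7 - (((k : ℝ) + 1) * a)⁻¹ ^ 13)) 0 →
    ∀ h : ℝ → ℝ, AntitoneOn h (Set.Ioi 0) →
    (∀ k : ℕ, MeasureTheory.IntegrableOn (fun t : ℝ => Real.exp (-(t * (((k : ℝ) + 1) * a)))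
      * (t ^ 5 / 720 - t ^ 11 / 479001600) * (t * h t)) (Set.Ioi 0)) →
    Summable (fun k : ℕ => ((k : ℝ) + 1) * ∫ t in Set.Ioi (0 : ℝ), Real.exp (-(t * (((k : ℝ) + 1) * a)))
      * (t ^ 5 / 720 - t ^ 11 / 479001600) * (t * h t)) →
    0 ≤ ∑' k : ℕ, ((k : ℝ) + 1) * ∫ t in Set.Ioi (0 : ℝ), Real.exp (-(t * (((k : ℝ) + 1) * a)))
      * (t ^ 5 / 720 - t ^ 11 / 479001600) * (t * h t) := by
  intro a ha hz h hh hint hsum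
  obtain ⟨t₀, ht₀, h6⟩ := exists_crossing
  have hterm : ∀ k : ℕ,
      h t₀ * (((k : ℝ) + 1) * ((((k : ℝ) + 1) * a)⁻¹ ^ 7 - (((k : ℝ) + 1) * a)⁻¹ ^ 13))
        ≤ ((k : ℝ) + 1) * ∫ t in Set.Ioi (0 : ℝ), Real.exp (-(t * (((k : ℝ) + 1) * a)))
          * (t ^ 5 / 720 - t ^ 11 / 479001600) * (t * h t) := by
    intro k
    have hk : (0 : ℝ) ≤ (k : ℝ) + 1 := by positivity
    have hb : 0 < ((k : ℝ) + 1) * a := by positivity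
    have hle := moment_mul_le_integral ht₀ h6 hh hb (hint k)
    calc h t₀ * (((k : ℝ) + 1) * ((((k : ℝ) + 1) * a)⁻¹ ^ 7 - (((k : ℝ) + 1) * a)⁻¹ ^ 13))
        = ((k : ℝ) + 1) * (h t₀ * ((((k : ℝ) + 1) * a)⁻¹ ^ 7 - (((k : ℝ) + 1) * a)⁻¹ ^ 13)) := by
          ring
      _ ≤ _ := mul_le_mul_of_nonneg_left hle hk
  have hR : HasSum (fun k : ℕ =>
      h t₀ * (((k : ℝ) + 1) * ((((k : ℝ) + 1) * a)⁻¹ ^ 7 - (((k : ℝ) + 1) * a)⁻¹ ^ 13))) 0 := by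
    have := hz.mul_left (h t₀)
    rwa [mul_zero] at this
  exact hasSum_le hterm hR hsum.hasSum

end Summit.AtomisticToContinuum.Crystallization.Theorems.ThreeConeCertificateExactCertificate.Transfer1D

end
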